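import Literature.AlgebraicGeometry.Kloosterman2025.PencilOfPairingsGenericMember
import HarnessLib

/-!
# Kloosterman, Lemma 2.5: some member of a pencil of two pairings has rank at least `r₁ + s₁`

R. Kloosterman, *On a conjecture on Hodge loci of linear combinations of linear subvarieties*,
Rend. Circ. Mat. Palermo (2) 74 (2025), doi:10.1007/s12215-025-01307-4 = arXiv:2312.12363, §2.3 'Bilinear maps'
[cite: Kloosterman2025, Notation 2.4, Lemma 2.5]. Sixth file of the series `PencilOfPairingsLeftKernel` /
`…KernelBounds` / `…ExceptionalValues` / `…Quotient` / `…GenericMember`; same encoding: a pairing `φ : V × W → K` is a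
curried map `B : V →ₗ[K] W →ₗ[K] K`, `ker_L φ = LinearMap.ker B`, `ker_R φ = LinearMap.ker B.flip`,
`rank φ = dim range B` (`= dim range B.flip`, `finrank_range_flip_eq`).

**Printed setting [cite: Kloosterman2025, Notation 2.4] (verbatim).** "Let `V` and `W` be `ℂ`-vector spaces. For `i=1,2`,
let `φ_i : V × W → ℂ` be bilinear maps. Let `V_i = ker_L(φ_i)`, `W_i = ker_R(φ_i)`. Suppose that `V₁ ∩ V₂ = 0` and
`W₁ ∩ W₂ = 0`. Let `r_i = rank φ_i` and let `s_i = rank φ_j|_{V_i × W_i}`" (§2.3 opens: "We will recall some well-known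
results on bilinear maps. We were not able to identify a place in the literature containing the following results in the
precise form we will need them.").

**Lemma 2.5 (verbatim).** "With the above notation, we have for `i=1,2`
`max{rank φ₁+tφ₂ : t ∈ ℂ*} ≥ r_i+s_i`."
Printed proof (induction on `s₁`): "It suffices to prove this first statement for `i=1`. We prove the statement by induction
on `s₁`. If `s₁=0` then there is nothing to prove. Suppose now `s₁>0`. Pick `v ∈ V₁, w ∈ W₁`, such that `φ₂(v,w) ≠ 0`. Let
`V'` be the orthogonal space of `w` with respect to `φ₂`, let `W'` be the orthogonal space of `v` with respect to `φ₂`. Then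
`V = ⟨v⟩ ⊕ V'` and `W = ⟨w⟩ ⊕ W'` are simultaneously orthogonal decompositions with respect to `φ₁,φ₂`, i.e.,
`φ_i(v,W') = 0` and `φ_i(V',w) = 0` hold for `i=1,2`. Let `ψ_i` be the restriction of `φ_i` to `V' × W'`. Then
`rank(ψ₁) = r₁`. Moreover, `ker_L(ψ₁) = ker_L(φ₁) ∩ V'` and `ker_R(ψ₁) = ker_R(φ₁) ∩ W'`. The rank of `ψ₂` on this space
`s₁−1`. Moreover the rank of `φ₁+tφ₂` on `⟨v⟩ × ⟨w⟩` is one for all nonzero `t`. I.e., by induction we have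
`max{rank φ₁+tφ₂ : t ∈ ℂ*} ≥ 1 + max{rank ψ₁+tψ₂ : t ∈ ℂ*} = r₁+s₁`."

**What this file proves** (sorry-free; `V`, `W` finite-dimensional over a field `K`). The restricted pairing
`φ₂|_{V₁ × W₁}` is encoded as `R := ((ker B₁.flip).dualRestrict ∘ₗ B₂).domRestrict (ker B₁) : V₁ →ₗ Dual W₁`, so
`s₁ = dim range R`; its left kernel is `ker B₁ ⊓ Y` with `Y := ker ((ker B₁.flip).dualRestrict ∘ₗ B₂) = {v : φ₂(v, W₁) = 0}`
(the encoding of `PencilOfPairingsKernelBounds.lean` / `…GenericMember.lean`), and `finrank_range_restrict_add` records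
`s₁ + dim(V₁ ∩ Y) = dim V₁`.
* `finite_and_ncard_finrank_ker_inf_lt` — for EVERY pair of pairings (no hypothesis): the set of `t ≠ 0` with
  `dim(V₁ ∩ Y) < dim ker_L(φ₁ + tφ₂)`, equivalently (`rank_add_smul_lt_iff`) with `rank(φ₁ + tφ₂) < r₁ + s₁`, is FINITE with at
  most `r₂` elements (rank form: `finite_and_ncard_rank_add_smul_lt`).
* **`exists_ne_zero_rank_add_smul_ge`** — Lemma 2.5 as printed for `i = 1`, over any INFINITE field: some `t ≠ 0` has
  `rank(φ₁ + tφ₂) ≥ r₁ + s₁`; **`exists_ne_zero_rank_add_smul_ge'`** — the case `i = 2`, `rank(φ₁ + tφ₂) ≥ r₂ + s₂`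
  (apply the first to `(φ₂, φ₁)` and invert `t`); kernel form `exists_ne_zero_finrank_ker_add_smul_le`.
The standing hypotheses `V₁ ∩ V₂ = 0`, `W₁ ∩ W₂ = 0` of Notation 2.4 are not needed and not assumed. `ℂ` is replaced by an
arbitrary infinite field; SOME largeness of `K` is necessary (over `𝔽₂` with `V = W = K`, `φ₁ = φ₂ = xy`: `r₁ = 1`, `s₁ = 0`,
but the only `t ∈ K*` is `t = 1` and `φ₁ + φ₂ = 0`).

Proof route (ONE deviation from the printed induction, which splits off `⟨v⟩ × ⟨w⟩`; recorded here): as in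
`PencilOfPairingsGenericMember.lean`, every `ker_L(φ₁ + tφ₂)` with `t ≠ 0` lies in `Y` (first line of the printed proof of
[cite: Kloosterman2025, Lemma 2.9]: `0 = φ₁(v,w) + tφ₂(v,w) = tφ₂(v,w)` for `w ∈ W₁`), so the pencil RESTRICTED to `Y × W`
has the same left kernels at `t ≠ 0`, while its member `t = 0` has left kernel exactly `V₁ ∩ Y = ker_L(φ₂|_{V₁×W₁})`, of
dimension `dim V₁ − s₁`; the maximal-minor count of `PencilOfPairingsExceptionalValues.lean` (= the printed first step of the
proof of [cite: Kloosterman2025, Lemma 2.6]: "The values of `t` for which the rank of `A₁+tA₂` is less than `dim V` are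
precisely the common zeros of all maximal minors of `A₁+tA₂`, which are polynomials in `t`") applied on `Y` with the member
`c₀ = 0` bounds the number of `t ≠ 0` with a larger kernel by `rank(φ₂|_Y) ≤ r₂` and proves their finiteness; for every
other `t ≠ 0`, `rank(φ₁ + tφ₂) = dim V − dim ker_L(φ₁ + tφ₂) ≥ dim V − dim V₁ + s₁ = r₁ + s₁`. This yields the printed
inequality together with the explicit count, uniformly in `s₁` (no induction).

Use (cell `pub-hlocus`, ENGINE B record `pub-hlocus-ivhs-2/ENGINEB-g31.md` §8b (K4)): for the Gorenstein catalecticant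
pairings of two cycle classes, `r₁ + s₁ = rk_cs + ρ(X)` by the dictionary of
`Summits/HodgeConjecture/HodgeLocus/Census/PencilLeftKernel.lean`, so this lemma is the "`≥`" half of THEOREM K⁼
(`g(X) = rk_cs + ρ(X)`); the "`≤`" half (K2) and the assembly live in `Summits/HodgeConjecture/HodgeLocus/Census/`.
Nothing else of §2.3 is formalised here (Lemmas 2.6, 2.8, 2.9 and Thm. 3.13 are the earlier files of the series).
HONEST FRAMING (cell pub-hlocus): certified instances and evidence bearing on the general Hodge conjecture; no claim.
-/

namespace Literature.AlgebraicGeometry.Kloosterman2025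

open Module

variable {K : Type*} [Field K] {V W : Type*} [AddCommGroup V] [Module K V] [AddCommGroup W] [Module K W]
  [FiniteDimensional K V] [FiniteDimensional K W]

section RestrictedRank

omit [FiniteDimensional K W] in
/-- **`s₁ + dim ker_L(φ₂|_{V₁ × W₁}) = dim V₁`**: rank–nullity for the restricted pairing
`R = φ₂|_{V₁ × W₁} : V₁ → Dual W₁` (`V₁ = ker_L φ₁`, `W₁ = ker_R φ₁`), whose kernel is `V₁ ∩ Y`,
`Y = {v : φ₂(v, W₁) = 0}`. [cite: Kloosterman2025, Notation 2.4] -/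
theorem finrank_range_restrict_add (B₁ B₂ : V →ₗ[K] W →ₗ[K] K) :
    finrank K (LinearMap.range
        (((LinearMap.ker B₁.flip).dualRestrict ∘ₗ B₂).domRestrict (LinearMap.ker B₁))) +
      finrank K ↥(LinearMap.ker B₁ ⊓ LinearMap.ker ((LinearMap.ker B₁.flip).dualRestrict ∘ₗ B₂)) =
      finrank K (LinearMap.ker B₁) := by
  set Y := LinearMap.ker ((LinearMap.ker B₁.flip).dualRestrict ∘ₗ B₂) with hY
  set R := ((LinearMap.ker B₁.flip).dualRestrict ∘ₗ B₂).domRestrict (LinearMap.ker B₁) with hR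
  have hker : LinearMap.ker R = (LinearMap.ker B₁ ⊓ Y).comap (LinearMap.ker B₁).subtype := by
    rw [hR, LinearMap.ker_domRestrict]
    ext ⟨v, hv⟩
    simp only [Submodule.mem_comap, Submodule.subtype_apply, Submodule.mem_inf, hY]
    exact ⟨fun h => ⟨hv, h⟩, fun h => h.2⟩
  have h := LinearMap.finrank_range_add_finrank_ker R
  rw [hker, (Submodule.comapSubtypeEquivOfLe
    (inf_le_left : LinearMap.ker B₁ ⊓ Y ≤ LinearMap.ker B₁)).finrank_eq] at h
  exact h

omit [FiniteDimensional K W] in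
/-- `rank(φ₁ + tφ₂) < r₁ + s₁ ↔ dim(V₁ ∩ Y) < dim ker_L(φ₁ + tφ₂)` (rank–nullity twice: `rank(φ₁ + tφ₂) = dim V − dim ker_L`,
`r₁ = dim V − dim V₁`, `s₁ = dim V₁ − dim(V₁ ∩ Y)`). [cite: Kloosterman2025, Notation 2.4, Lemma 2.5] -/
theorem rank_add_smul_lt_iff (B₁ B₂ : V →ₗ[K] W →ₗ[K] K) (c : K) :
    finrank K (LinearMap.range (B₁ + c • B₂)) <
        finrank K (LinearMap.range B₁) +
          finrank K (LinearMap.range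
            (((LinearMap.ker B₁.flip).dualRestrict ∘ₗ B₂).domRestrict (LinearMap.ker B₁))) ↔
      finrank K ↥(LinearMap.ker B₁ ⊓ LinearMap.ker ((LinearMap.ker B₁.flip).dualRestrict ∘ₗ B₂)) <
        finrank K (LinearMap.ker (B₁ + c • B₂)) := by
  have h1 := LinearMap.finrank_range_add_finrank_ker (B₁ + c • B₂)
  have h2 := LinearMap.finrank_range_add_finrank_ker B₁
  have h3 := finrank_range_restrict_add B₁ B₂
  omega

end RestrictedRank

section Count

/-- **The exceptional set of Lemma 2.5 is finite, with at most `r₂` elements** (no hypothesis on the pairings): the `t ≠ 0` with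
`dim(V₁ ∩ Y) < dim ker_L(φ₁ + tφ₂)`, `V₁ = ker_L φ₁`, `Y = {v : φ₂(v, ker_R φ₁) = 0}` — equivalently (`rank_add_smul_lt_iff`) with
`rank(φ₁ + tφ₂) < r₁ + s₁`. Route: restrict the pencil to `Y`, where the member `t = 0` has left kernel `V₁ ∩ Y` and the members
`t ≠ 0` keep their left kernels (`ker_add_smul_le_ker_dualRestrict_comp`); count and finiteness on `Y` by
`ncard_finrank_leftKernel_gt_add_le` / `setOf_finrank_leftKernel_gt_finite` (the maximal-minor argument printed at the start of the
proof of Lemma 2.6). [cite: Kloosterman2025, Lemma 2.5, Lemma 2.6 (proof, first step)] -/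
theorem finite_and_ncard_finrank_ker_inf_lt (B₁ B₂ : V →ₗ[K] W →ₗ[K] K) :
    {c : K | c ≠ 0 ∧
        finrank K ↥(LinearMap.ker B₁ ⊓ LinearMap.ker ((LinearMap.ker B₁.flip).dualRestrict ∘ₗ B₂)) <
          finrank K (LinearMap.ker (B₁ + c • B₂))}.Finite ∧
      {c : K | c ≠ 0 ∧
        finrank K ↥(LinearMap.ker B₁ ⊓ LinearMap.ker ((LinearMap.ker B₁.flip).dualRestrict ∘ₗ B₂)) <
          finrank K (LinearMap.ker (B₁ + c • B₂))}.ncard ≤ finrank K (LinearMap.range B₂) := by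
  set Y : Submodule K V := LinearMap.ker ((LinearMap.ker B₁.flip).dualRestrict ∘ₗ B₂) with hY
  set N : Submodule K V := LinearMap.ker B₁ ⊓ Y with hN
  -- the restricted pencil on `Y`
  set R₁ : Y →ₗ[K] W →ₗ[K] K := B₁.domRestrict Y with hR₁
  set R₂ : Y →ₗ[K] W →ₗ[K] K := B₂.domRestrict Y with hR₂
  have hR : ∀ c : K, (B₁ + c • B₂).domRestrict Y = R₁ + c • R₂ := fun c => by
    ext y w
    simp [hR₁, hR₂, LinearMap.domRestrict_apply]
  -- `N ≤ Y` and `ker_L(b₁|_Y) ≅ N`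
  have hNY : N ≤ Y := inf_le_right
  have hkerR₁ : LinearMap.ker R₁ = N.comap Y.subtype := by
    rw [hR₁, LinearMap.ker_domRestrict]
    ext ⟨y, hy⟩
    simp only [Submodule.mem_comap, Submodule.subtype_apply, hN, Submodule.mem_inf]
    exact ⟨fun h1 => ⟨h1, hy⟩, fun h => h.1⟩
  have hfinN : finrank K (LinearMap.ker R₁) = finrank K N := by
    rw [hkerR₁]
    exact (Submodule.comapSubtypeEquivOfLe hNY).finrank_eq
  -- for `c ≠ 0` the kernels of the pencil and of the restricted pencil agree in dimension
  have hkerc : ∀ {c : K}, c ≠ 0 →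
      finrank K (LinearMap.ker (R₁ + c • R₂)) = finrank K (LinearMap.ker (B₁ + c • B₂)) := by
    intro c hc
    rw [← hR, LinearMap.ker_domRestrict]
    exact (Submodule.comapSubtypeEquivOfLe (ker_add_smul_le_ker_dualRestrict_comp B₁ B₂ hc)).finrank_eq
  -- the count and the finiteness on `Y`, with `s = dim Y − dim N` and the member `c₀ = 0`
  have hNle : finrank K N ≤ finrank K Y := Submodule.finrank_mono hNY
  have h0 : finrank K (LinearMap.ker (R₁ + (0 : K) • R₂)) + (finrank K Y - finrank K N) ≤ finrank K Y := by
    rw [zero_smul, add_zero, hfinN]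
    omega
  have hcount := ncard_finrank_leftKernel_gt_add_le R₁ R₂ h0
  have hfin := setOf_finrank_leftKernel_gt_finite R₁ R₂ h0
  have hrk₁ : finrank K (LinearMap.range R₁) + finrank K N = finrank K Y := by
    rw [← hfinN]; exact LinearMap.finrank_range_add_finrank_ker R₁
  have hrk₂ : finrank K (LinearMap.range R₂) ≤ finrank K (LinearMap.range B₂) :=
    Submodule.finrank_mono (LinearMap.range_domRestrict_le_range B₂ Y)
  have hsub : finrank K Y - (finrank K Y - finrank K N) = finrank K N := by omega
  -- the two exceptional sets coincide
  have hset : {c : K | c ≠ 0 ∧ finrank K ↥N < finrank K (LinearMap.ker (B₁ + c • B₂))} =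
      {c : K | c ≠ 0 ∧ finrank K Y - (finrank K Y - finrank K N) <
        finrank K (LinearMap.ker (R₁ + c • R₂))} := by
    ext c
    simp only [Set.mem_setOf_eq]
    constructor
    · rintro ⟨hc, hlt⟩
      exact ⟨hc, by rw [hsub, hkerc hc]; exact hlt⟩
    · rintro ⟨hc, hlt⟩
      exact ⟨hc, by rw [hsub, hkerc hc] at hlt; exact hlt⟩
  refine ⟨?_, ?_⟩
  · rw [hset]
    exact hfin.subset fun c hc => hc.2
  · rw [hset]
    omega

/-- **Finiteness and count in rank form**: `{t ≠ 0 : rank(φ₁ + tφ₂) < r₁ + s₁}` is finite, with at most `r₂ = rank φ₂` elements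
(`s₁ = rank φ₂|_{ker_L φ₁ × ker_R φ₁}`). [cite: Kloosterman2025, Lemma 2.5] -/
theorem finite_and_ncard_rank_add_smul_lt (B₁ B₂ : V →ₗ[K] W →ₗ[K] K) :
    {c : K | c ≠ 0 ∧ finrank K (LinearMap.range (B₁ + c • B₂)) <
        finrank K (LinearMap.range B₁) +
          finrank K (LinearMap.range
            (((LinearMap.ker B₁.flip).dualRestrict ∘ₗ B₂).domRestrict (LinearMap.ker B₁)))}.Finite ∧
      {c : K | c ≠ 0 ∧ finrank K (LinearMap.range (B₁ + c • B₂)) <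
        finrank K (LinearMap.range B₁) +
          finrank K (LinearMap.range
            (((LinearMap.ker B₁.flip).dualRestrict ∘ₗ B₂).domRestrict (LinearMap.ker B₁)))}.ncard ≤
        finrank K (LinearMap.range B₂) := by
  have hset : {c : K | c ≠ 0 ∧ finrank K (LinearMap.range (B₁ + c • B₂)) <
        finrank K (LinearMap.range B₁) +
          finrank K (LinearMap.range
            (((LinearMap.ker B₁.flip).dualRestrict ∘ₗ B₂).domRestrict (LinearMap.ker B₁)))} =
      {c : K | c ≠ 0 ∧
        finrank K ↥(LinearMap.ker B₁ ⊓ LinearMap.ker ((LinearMap.ker B₁.flip).dualRestrict ∘ₗ B₂)) <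
          finrank K (LinearMap.ker (B₁ + c • B₂))} := by
    ext c
    simp only [Set.mem_setOf_eq, rank_add_smul_lt_iff]
  rw [hset]
  exact finite_and_ncard_finrank_ker_inf_lt B₁ B₂

end Count

section Infinite

/-- Kernel form of Lemma 2.5 over an infinite field: some `t ≠ 0` (indeed every `t ≠ 0` outside a set of at most `r₂` elements)
has `dim ker_L(φ₁ + tφ₂) ≤ dim(V₁ ∩ Y) = dim ker_L(φ₂|_{V₁ × W₁}) = dim V₁ − s₁`. [cite: Kloosterman2025, Lemma 2.5] -/
theorem exists_ne_zero_finrank_ker_add_smul_le [Infinite K] (B₁ B₂ : V →ₗ[K] W →ₗ[K] K) :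
    ∃ t : K, t ≠ 0 ∧ finrank K (LinearMap.ker (B₁ + t • B₂)) ≤
      finrank K ↥(LinearMap.ker B₁ ⊓ LinearMap.ker ((LinearMap.ker B₁.flip).dualRestrict ∘ₗ B₂)) := by
  obtain ⟨hfin, -⟩ := finite_and_ncard_finrank_ker_inf_lt B₁ B₂
  obtain ⟨t, ht⟩ := (hfin.union (Set.finite_singleton (0 : K))).infinite_compl.nonempty
  simp only [Set.mem_compl_iff, Set.mem_union, Set.mem_setOf_eq, Set.mem_singleton_iff, not_or, not_and,
    not_lt] at ht
  exact ⟨t, ht.2, ht.1 ht.2⟩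

/-- **Kloosterman, Lemma 2.5 (`i = 1`), over any infinite field** (e.g. `ℚ`, `ℂ`): "`max{rank φ₁+tφ₂ : t ∈ ℂ*} ≥ r₁+s₁`" —
some `t ≠ 0` (indeed every `t ≠ 0` outside a set of at most `r₂` elements, `finite_and_ncard_rank_add_smul_lt`) has
`rank(φ₁ + tφ₂) ≥ r₁ + s₁`, where `r₁ = rank φ₁` and `s₁ = rank φ₂|_{ker_L φ₁ × ker_R φ₁}`. [cite: Kloosterman2025, Lemma 2.5] -/
theorem exists_ne_zero_rank_add_smul_ge [Infinite K] (B₁ B₂ : V →ₗ[K] W →ₗ[K] K) :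
    ∃ t : K, t ≠ 0 ∧ finrank K (LinearMap.range B₁) +
        finrank K (LinearMap.range
          (((LinearMap.ker B₁.flip).dualRestrict ∘ₗ B₂).domRestrict (LinearMap.ker B₁))) ≤
      finrank K (LinearMap.range (B₁ + t • B₂)) := by
  obtain ⟨hfin, -⟩ := finite_and_ncard_rank_add_smul_lt B₁ B₂
  obtain ⟨t, ht⟩ := (hfin.union (Set.finite_singleton (0 : K))).infinite_compl.nonempty
  simp only [Set.mem_compl_iff, Set.mem_union, Set.mem_setOf_eq, Set.mem_singleton_iff, not_or, not_and,
    not_lt] at ht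
  exact ⟨t, ht.2, ht.1 ht.2⟩

/-- **Kloosterman, Lemma 2.5 (`i = 2`)**: some `t ≠ 0` has `rank(φ₁ + tφ₂) ≥ r₂ + s₂`, `s₂ = rank φ₁|_{ker_L φ₂ × ker_R φ₂}`
("It suffices to prove this first statement for `i=1`": apply the case `i = 1` to `(φ₂, φ₁)` and invert the parameter,
`φ₁ + tφ₂ = t·(φ₂ + t⁻¹φ₁)` has the rank of `φ₂ + t⁻¹φ₁`). [cite: Kloosterman2025, Lemma 2.5] -/
theorem exists_ne_zero_rank_add_smul_ge' [Infinite K] (B₁ B₂ : V →ₗ[K] W →ₗ[K] K) :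
    ∃ t : K, t ≠ 0 ∧ finrank K (LinearMap.range B₂) +
        finrank K (LinearMap.range
          (((LinearMap.ker B₂.flip).dualRestrict ∘ₗ B₁).domRestrict (LinearMap.ker B₂))) ≤
      finrank K (LinearMap.range (B₁ + t • B₂)) := by
  obtain ⟨u, hu, h⟩ := exists_ne_zero_rank_add_smul_ge B₂ B₁
  refine ⟨u⁻¹, inv_ne_zero hu, ?_⟩
  have e : B₁ + u⁻¹ • B₂ = u⁻¹ • (B₂ + u • B₁) := by
    rw [smul_add, smul_smul, inv_mul_cancel₀ hu, one_smul, add_comm]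
  rw [e, LinearMap.range_smul _ _ (inv_ne_zero hu)]
  exact h

end Infinite

end Literature.AlgebraicGeometry.Kloosterman2025
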